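import Literature.Analysis.FluidPDE.EmpiricalCollisionMeasureMeasurable
import HarnessLib

/-!
# Collision sums with label-dependent summands are measurable in the initial datum

`Literature.Analysis.FluidPDE.EmpiricalCollisionMeasureMeasurable` proves that along a hard-sphere
flow `Φ` (regular measurable geometry) the collision sum `z ↦ Σ_{collisions in (a, b]} f (mark)`
of a CONTINUOUS function `f` of the collision mark `(t, x_fst, ω, v_fst⁻, v_snd⁻)`, extended by
`0` off the good set, is measurable in the initial datum `z` (velocity-jump detection over dyadic
cells; time-slice measurability of the flow only). The mark carries no particle LABELS, so that
engine does not cover summands such as `1{c.fst = i} · (impulse of c)` (per-particle running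
activities, tagged-particle functionals, label-indexed clamps). This file is the label-aware
version: for a family `F i j` of continuous (and measurable) functions of the mark indexed by the
ORDERED colliding pair `(i, j) = (c.fst, c.snd)`, the functional
`z ↦ Φ.collisionSum (Ioc a b) (fun c => F c.fst c.snd c.mark) z`, extended by `0` off the good
set, is measurable (`HardSphereFlow.measurable_indicator_collisionSum_Ioc_labels`), hence
a.e.-measurable under every law carried by the good set
(`HardSphereFlow.aemeasurable_of_eqOn_collisionSum_labels`; torus specialisations `…_torus`,
`ε < 1/2`, continuity only). Also recorded: the congruence of collision sums along the records of
a curve (`collisionSum_congr`), by which a summand that agrees with some `F c.fst c.snd c.mark` ON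
THE COLLISIONS OF THE ORBIT (e.g. through the elastic law read off the mark) inherits
measurability (`HardSphereFlow.measurable_indicator_of_eqOn_collisionSum_labels`).

## The argument, Mathlib / Literature reuse

Verbatim the label-free one: the rank-`n` approximant `labelCollisionSumApprox … n` sums, over the
`2^n` dyadic cells of `(a, b]`, the label-aware velocity-jump sums `labelJumpSum` — which range
over ORDERED label pairs `(i, j)` anyway, so may evaluate `F i j` at the cell mark; on a fine cell
this detects the two ordered pairs of the cell's collision with their labels
(`IsHardSphereTrajectory.labelJumpSum_eq`, `labelJumpSum_cell_eq`), the cell marks converge to the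
collision marks (`IsHardSphereTrajectory.tendsto_cellMark`), so
`labelCollisionSumApprox … n → collisionSum … (Ioc a b) (fun c => F c.fst c.snd c.mark)` on the
good set (`tendsto_labelCollisionSumApprox`) and `measurable_of_tendsto_metrizable` concludes.
Cells, meshes and cell marks (`cellMark`, `meshPt`, `cellIndex`, `eventually_fine`,
`tendsto_cellMark`, `measurable_cellMark`, …) are the label-free file's, reused not copied
(`jumpSum` is the constant-family case); `measurable_of_tendsto_metrizable`, `tendsto_finsetSum`,
`Finset.sum_fiberwise_of_maps_to`, `finsum_mem_congr` are Mathlib's. Families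
`F : Fin N → Fin N → (mark space) → E` (not functions on the measurable record type of
`HardSphereCollisionRecordMeasurable`): continuity in the mark at fixed labels is what the
convergence consumes, and `fun c => F c.fst c.snd c.mark` is the form in which label tests occur.

## References

* I. Gallagher, L. Saint-Raymond, B. Texier, *From Newton to Boltzmann* (2013), §4.1, Prop. 4.1.1,
  Def. 4.1.2 (collisions of the hard-sphere flow: time, ordered pair, impact direction, velocities).
* M. Pulvirenti, S. Simonella, *On the evolution of the empirical measure for the hard-sphere
  dynamics*, arXiv:1504.03215 (2015), §3 (collision sums along one trajectory).
-/

open Set Filter Function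
open _root_.MeasureTheory _root_.Topology
open scoped ENNReal Topology InnerProductSpace

namespace Literature.Analysis.FluidPDE

noncomputable section

section Kinetic

variable {d : Type*} [Fintype d] {X : Type*} {N : ℕ}

/-! ## Congruence of collision sums along the records of a curve -/

/-- Two functionals of the record that agree on the records of the collisions of the curve `γ`
with times in `S` (ordered contact pairs of collision times) have the same collision sum over `S`.
[folklore] -/
theorem collisionSum_congr {M : Type*} [AddCommMonoid M] {G : Geometry d X} {ε : ℝ}
    {γ : ℝ → Config N d X} {S : Set ℝ} {F F' : HardSphereCollisionRecord d X N → M}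
    (h : ∀ t ∈ collisionTimes G ε γ ∩ S, ∀ p ∈ contactPairs G ε (γ t),
      F (HardSphereCollisionRecord.ofConfig G ε (γ t) t p.1 p.2) =
        F' (HardSphereCollisionRecord.ofConfig G ε (γ t) t p.1 p.2)) :
    collisionSum G ε γ S F = collisionSum G ε γ S F' := by
  unfold collisionSum collisionPairSum
  exact finsum_mem_congr rfl fun t ht => Finset.sum_congr rfl (h t ht)

/-! ## Label-aware velocity-jump detection over a time cell -/

/-- The **label-aware velocity-jump sum** of the family `F` over the cell `(l, r]`: the sum of
`F i j (cellMark …)` over the ordered pairs `i ≠ j` of particles BOTH of whose velocities differ at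
times `l` and `r` (`jumpSum G ε γ f` is `labelJumpSum G ε γ (fun _ _ => f)`, by `rfl`); on a cell
with a single collision it detects its two ordered pairs WITH THEIR LABELS. [folklore] -/
def labelJumpSum {M : Type*} [AddCommMonoid M] (G : Geometry d X) (ε : ℝ) (γ : ℝ → Config N d X)
    (F : Fin N → Fin N → ℝ × X × EuclideanSpace ℝ d × EuclideanSpace ℝ d × EuclideanSpace ℝ d → M)
    (l r : ℝ) : M :=
  ∑ i, ∑ j, if i ≠ j ∧ (γ r i).2 ≠ (γ l i).2 ∧ (γ r j).2 ≠ (γ l j).2 then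
    F i j (cellMark G ε γ l r i j) else 0

/-- The **label-aware dyadic velocity-jump approximation** of rank `n` of the collision sum of
`fun c => F c.fst c.snd c.mark` over the window `(a, b]`: the sum of the label-aware velocity-jump
sums over the `2^n` dyadic cells of `(a, b]`. It converges to that collision sum along every
hard-sphere trajectory (`IsHardSphereTrajectory.tendsto_labelCollisionSumApprox`). [folklore] -/
def labelCollisionSumApprox {M : Type*} [AddCommMonoid M] (G : Geometry d X) (ε : ℝ)
    (γ : ℝ → Config N d X)
    (F : Fin N → Fin N → ℝ × X × EuclideanSpace ℝ d × EuclideanSpace ℝ d × EuclideanSpace ℝ d → M)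
    (a b : ℝ) (n : ℕ) : M :=
  ∑ k ∈ Finset.range (2 ^ n), labelJumpSum G ε γ F (meshPt a b n k) (meshPt a b n (k + 1))

namespace IsHardSphereTrajectory

variable [TopologicalSpace X] {G : Geometry d X} {ε : ℝ} {γ : ℝ → Config N d X} {M : Type*}
  [AddCommMonoid M]
  (F : Fin N → Fin N → ℝ × X × EuclideanSpace ℝ d × EuclideanSpace ℝ d × EuclideanSpace ℝ d → M)

/-- **The label-aware velocity-jump sum on a fine cell.** If every collision time of a
hard-sphere trajectory (regular geometry) in the cell `(l, r]` equals `s ∈ (l, r]`, the sum over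
the cell is the sum of `F i j (cellMark … i j)` over the ordered contact pairs `(i, j)` at time `s`
(empty if `s` is not a collision time). [folklore] -/
theorem labelJumpSum_eq (h : IsHardSphereTrajectory G ε N γ) (hG : G.IsHardSphereRegular ε)
    {l r s : ℝ} (hs : s ∈ Ioc l r) (hsub : ∀ t ∈ collisionTimes G ε γ, t ∈ Ioc l r → t = s) :
    labelJumpSum G ε γ F l r =
      ∑ p ∈ contactPairs G ε (γ s), F p.1 p.2 (cellMark G ε γ l r p.1 p.2) := by
  classical
  -- free flight on `(s, r]`
  have hsr : ∀ k, (γ r k).2 = (γ s k).2 := by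
    intro k
    rw [h.free s r hs.2 (fun τ hτ hcol => ?_), freeFlight_apply]
    have := hsub τ hcol ⟨hs.1.trans hτ.1, hτ.2⟩
    linarith [hτ.1]
  by_cases hcol : s ∈ collisionTimes G ε γ
  · obtain ⟨p, q, hpq, hc⟩ := hcol
    have hpmem : (p, q) ∈ contactPairs G ε (γ s) := mem_contactPairs.2 ⟨hpq, hc⟩
    -- the pre-collisional velocities are the velocities at time `l`
    have hpre : ∀ k, (collidePair G p q (γ s) k).2 = (γ l k).2 :=
      h.collidePair_vel_eq hs.1 (fun τ hτ hcol => by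
        have := hsub τ hcol ⟨hτ.1, hτ.2.le.trans hs.2⟩
        linarith [hτ.2]) hpq hc
    have hjump : ∀ k, (γ r k).2 ≠ (γ l k).2 ↔ k = p ∨ k = q := fun k => by
      rw [hsr k, ← hpre k]
      exact h.vel_ne_collidePair_iff hpq hc k
    rw [labelJumpSum, h.contactPairs_eq_pair hG hpmem]
    rw [← sum_sum_ite_mem_eq (S := {(p, q), (q, p)}) fun i j => F i j (cellMark G ε γ l r i j)]
    refine Finset.sum_congr rfl fun i _ => Finset.sum_congr rfl fun j _ => ?_
    refine if_congr ?_ rfl rfl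
    rw [hjump i, hjump j, Finset.mem_insert, Finset.mem_singleton, Prod.mk.injEq, Prod.mk.injEq]
    constructor
    · rintro ⟨hij, hi | hi, hj | hj⟩ <;> subst hi <;> subst hj <;> tauto
    · rintro (⟨rfl, rfl⟩ | ⟨rfl, rfl⟩)
      · exact ⟨hpq, Or.inl rfl, Or.inr rfl⟩
      · exact ⟨hpq.symm, Or.inr rfl, Or.inl rfl⟩
  · rw [contactPairs_eq_empty_of_not_mem hcol, Finset.sum_empty]
    refine Finset.sum_eq_zero fun i _ => Finset.sum_eq_zero fun j _ => if_neg fun hij => hij.2.1 ?_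
    rw [hsr i, h.free l s hs.1.le (fun τ hτ hc' => ?_), freeFlight_apply]
    rcases hτ.2.eq_or_lt with rfl | hlt'
    · exact hcol hc'
    · have := hsub τ hc' ⟨hτ.1, hτ.2.trans hs.2⟩
      linarith

/-- **The label-aware velocity-jump sum of one cell of a fine mesh** is the sum, over the
collision times of the window with that cell index (at most one), of `F i j (cellMark … i j)` over
their ordered contact pairs. [folklore] -/
theorem labelJumpSum_cell_eq (h : IsHardSphereTrajectory G ε N γ) (hG : G.IsHardSphereRegular ε)
    {a b : ℝ} (hab : a < b) (hfin : (collisionTimes G ε γ ∩ Ioc a b).Finite) {n : ℕ}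
    (hfine : ∀ s ∈ hfin.toFinset, ∀ s' ∈ hfin.toFinset, s ≠ s' →
      (b - a) / 2 ^ n < |s - s'|) {k : ℕ} (hk : k < 2 ^ n) :
    labelJumpSum G ε γ F (meshPt a b n k) (meshPt a b n (k + 1)) =
      ∑ s ∈ hfin.toFinset with cellIndex a b n s = k, ∑ p ∈ contactPairs G ε (γ s),
        F p.1 p.2 (cellMark G ε γ (meshPt a b n k) (meshPt a b n (k + 1)) p.1 p.2) := by
  have hmesh : 0 < (b - a) / 2 ^ n := div_pos (sub_pos.2 hab) (by positivity)
  have hcell : meshPt a b n k < meshPt a b n (k + 1) := by rw [meshPt_succ]; linarith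
  rcases (hfin.toFinset.filter fun s => cellIndex a b n s = k).eq_empty_or_nonempty with
    he | ⟨s₀, hs₀⟩
  · rw [he, Finset.sum_empty]
    have hno : ∀ t ∈ collisionTimes G ε γ,
        t ∉ Ioc (meshPt a b n k) (meshPt a b n (k + 1)) := by
      intro t ht htk
      obtain ⟨hT, hidx⟩ := mem_toFinset_of_mem_cell hab hfin hk ht htk
      have : t ∈ hfin.toFinset.filter fun s => cellIndex a b n s = k :=
        Finset.mem_filter.2 ⟨hT, hidx⟩
      rw [he] at this
      exact Finset.notMem_empty t this
    rw [h.labelJumpSum_eq F hG (s := meshPt a b n (k + 1)) ⟨hcell, le_rfl⟩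
      (fun t ht htk => absurd htk (hno t ht)), contactPairs_eq_empty_of_not_mem
      (fun hc => hno _ hc ⟨hcell, le_rfl⟩), Finset.sum_empty]
  · obtain ⟨hs₀T, hidx₀⟩ := Finset.mem_filter.1 hs₀
    have hs₀cell : s₀ ∈ Ioc (meshPt a b n k) (meshPt a b n (k + 1)) := by
      have := (mem_cell_cellIndex hab n (hfin.mem_toFinset.1 hs₀T).2).2
      rwa [hidx₀] at this
    -- by fineness `s₀` is the only collision time of the window in this cell
    have huniq : ∀ t ∈ collisionTimes G ε γ,
        t ∈ Ioc (meshPt a b n k) (meshPt a b n (k + 1)) → t = s₀ := by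
      intro t ht htk
      by_contra hne
      have hT := (mem_toFinset_of_mem_cell hab hfin hk ht htk).1
      exact (lt_irrefl _) ((hfine t hT s₀ hs₀T hne).trans (sub_lt_of_mem_cell htk hs₀cell))
    have hfilter : (hfin.toFinset.filter fun s => cellIndex a b n s = k) = {s₀} := by
      refine Finset.eq_singleton_iff_unique_mem.2 ⟨hs₀, fun t ht => ?_⟩
      obtain ⟨htT, hidx⟩ := Finset.mem_filter.1 ht
      have htcell : t ∈ Ioc (meshPt a b n k) (meshPt a b n (k + 1)) := by
        have := (mem_cell_cellIndex hab n (hfin.mem_toFinset.1 htT).2).2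
        rwa [hidx] at this
      exact huniq t (hfin.mem_toFinset.1 htT).1 htcell
    rw [hfilter, Finset.sum_singleton]
    exact h.labelJumpSum_eq F hG hs₀cell huniq

variable {F} in
/-- **Convergence of the label-aware dyadic velocity-jump approximation.** Along a hard-sphere
trajectory in a regular geometry, for a family `F i j` of continuous functions of the mark, the
rank-`n` approximation over `(a, b]` converges to `Σ_{collisions in (a, b]} Σ_{ordered contact
pairs (i, j)} F i j (mark) = collisionSum G ε γ (Ioc a b) (fun c => F c.fst c.snd c.mark)`.
[folklore] -/
theorem tendsto_labelCollisionSumApprox [TopologicalSpace M] [ContinuousAdd M]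
    (h : IsHardSphereTrajectory G ε N γ) (hG : G.IsHardSphereRegular ε) {a b : ℝ} (hab : a < b)
    (hF : ∀ i j, Continuous (F i j)) :
    Tendsto (fun n => labelCollisionSumApprox G ε γ F a b n) atTop
      (𝓝 (collisionSum G ε γ (Ioc a b) fun c => F c.fst c.snd c.mark)) := by
  have hfin : (collisionTimes G ε γ ∩ Ioc a b).Finite :=
    h.finite_collisionTimes_inter_of_subset_Icc Ioc_subset_Icc_self
  rw [collisionSum_eq_finset_sum hfin]
  simp only [HardSphereCollisionRecord.ofConfig_fst, HardSphereCollisionRecord.ofConfig_snd]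
  have hfine := eventually_fine hfin a b
  -- the approximants, rewritten as sums over the collision times
  have happrox : ∀ᶠ n in atTop, (∑ s ∈ hfin.toFinset, ∑ p ∈ contactPairs G ε (γ s),
      F p.1 p.2 (cellMark G ε γ (meshPt a b n (cellIndex a b n s))
        (meshPt a b n (cellIndex a b n s + 1)) p.1 p.2)) =
        labelCollisionSumApprox G ε γ F a b n := by
    filter_upwards [hfine] with n hn
    have hmaps : ∀ s ∈ hfin.toFinset, cellIndex a b n s ∈ Finset.range (2 ^ n) := fun s hs =>
      Finset.mem_range.2 (mem_cell_cellIndex hab n (hfin.mem_toFinset.1 hs).2).1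
    symm
    calc labelCollisionSumApprox G ε γ F a b n
        = ∑ k ∈ Finset.range (2 ^ n), ∑ s ∈ hfin.toFinset with cellIndex a b n s = k,
            ∑ p ∈ contactPairs G ε (γ s),
              F p.1 p.2 (cellMark G ε γ (meshPt a b n k) (meshPt a b n (k + 1)) p.1 p.2) :=
          Finset.sum_congr rfl fun k hk =>
            h.labelJumpSum_cell_eq F hG hab hfin hn (Finset.mem_range.1 hk)
      _ = ∑ k ∈ Finset.range (2 ^ n), ∑ s ∈ hfin.toFinset with cellIndex a b n s = k,
            ∑ p ∈ contactPairs G ε (γ s),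
              F p.1 p.2 (cellMark G ε γ (meshPt a b n (cellIndex a b n s))
                (meshPt a b n (cellIndex a b n s + 1)) p.1 p.2) :=
          Finset.sum_congr rfl fun k _ => Finset.sum_congr rfl fun s hs => by
            rw [(Finset.mem_filter.1 hs).2]
      _ = _ := Finset.sum_fiberwise_of_maps_to hmaps _
  refine Tendsto.congr' happrox (tendsto_finsetSum _ fun s hs => tendsto_finsetSum _ fun p hp => ?_)
  -- convergence of each term
  obtain ⟨hsC, hsI⟩ := hfin.mem_toFinset.1 hs
  have hcell := fun n => (mem_cell_cellIndex hab n hsI).2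
  have hmesh : ∀ n, meshPt a b n (cellIndex a b n s + 1) =
      meshPt a b n (cellIndex a b n s) + (b - a) / 2 ^ n := fun n => meshPt_succ a b n _
  have hr' : Tendsto (fun n => meshPt a b n (cellIndex a b n s + 1)) atTop (𝓝 s) := by
    refine tendsto_of_tendsto_of_tendsto_of_le_of_le tendsto_const_nhds
      (by simpa using (tendsto_meshSize a b).const_add s) (fun n => (hcell n).2) fun n => ?_
    have := (hcell n).1
    rw [hmesh n]
    linarith
  -- in a fine mesh the rest of the cell of `s` is collision-free
  have hfree : ∀ᶠ n in atTop, ∀ τ ∈ collisionTimes G ε γ,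
      τ ∈ Ioc (meshPt a b n (cellIndex a b n s)) (meshPt a b n (cellIndex a b n s + 1)) →
        τ = s := by
    filter_upwards [hfine] with n hn τ hτ hτcell
    by_contra hne
    have hidx := (mem_cell_cellIndex hab n hsI).1
    have hT := (mem_toFinset_of_mem_cell hab hfin hidx hτ hτcell).1
    exact (lt_irrefl _) ((hn τ hT s hs hne).trans (sub_lt_of_mem_cell hτcell (hcell n)))
  obtain ⟨i, j⟩ := p
  refine ((hF i j).tendsto _).comp (h.tendsto_cellMark hG hp (fun n => (hcell n).1)
    (fun n => (hcell n).2) hr' ?_ ?_)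
  · filter_upwards [hfree] with n hn τ hτ hτC
    have := hn τ hτC ⟨hτ.1, hτ.2.le.trans (hcell n).2⟩
    linarith [hτ.2]
  · filter_upwards [hfree] with n hn τ hτ hτC
    have := hn τ hτC ⟨(hcell n).1.trans hτ.1, hτ.2⟩
    linarith [hτ.1]

end IsHardSphereTrajectory

/-! ## Measurability in the initial datum along a hard-sphere flow -/

namespace HardSphereFlow

variable [MeasureSpace X] [TopologicalSpace X] {G : Geometry d X} {ε : ℝ}
  (Φ : HardSphereFlow G ε N)

variable {E : Type*} [AddCommMonoid E] [MeasurableSpace E]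
  {F : Fin N → Fin N → ℝ × X × EuclideanSpace ℝ d × EuclideanSpace ℝ d × EuclideanSpace ℝ d → E}

/-- The label-aware velocity-jump sum over a fixed cell, read off the orbit of `z`, is measurable
in `z` (point evaluations of the flow at the two fixed times only). [folklore] -/
theorem measurable_labelJumpSum [MeasurableAdd₂ E] (hGm : G.IsMeasurable)
    (hF : ∀ i j, Measurable (F i j)) (l r : ℝ) :
    Measurable fun z => labelJumpSum G ε (fun t => Φ.flow t z) F l r := by
  unfold labelJumpSum
  refine Finset.measurable_sum _ fun i _ => Finset.measurable_sum _ fun j _ => ?_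
  have hv : ∀ (t : ℝ) (k : Fin N), Measurable fun z : Config N d X => (Φ.flow t z k).2 :=
    fun t k => (Geometry.IsMeasurable.measurable_vel k).comp (Φ.measurable_flow t)
  refine Measurable.ite ?_ ((hF i j).comp (Φ.measurable_cellMark hGm l r i j)) measurable_const
  exact (MeasurableSet.const _).inter (((measurableSet_eq_fun (hv r i) (hv l i)).compl).inter
    (measurableSet_eq_fun (hv r j) (hv l j)).compl)

/-- The rank-`n` label-aware approximation, read off the orbit, is measurable in `z`. [folklore] -/
theorem measurable_labelCollisionSumApprox [MeasurableAdd₂ E] (hGm : G.IsMeasurable)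
    (hF : ∀ i j, Measurable (F i j)) (a b : ℝ) (n : ℕ) :
    Measurable fun z => labelCollisionSumApprox G ε (fun t => Φ.flow t z) F a b n :=
  Finset.measurable_sum _ fun _ _ => Φ.measurable_labelJumpSum hGm hF _ _

/-- **Measurability of label-dependent collision sums over `(a, b]` in the initial datum.**
Along a hard-sphere flow in a regular measurable geometry, for a family `F i j` of continuous and
measurable functions of the mark indexed by the ordered colliding pair, the collision sum
`z ↦ Σ_{collisions c of the orbit of z in (a, b]} F c.fst c.snd c.mark`, extended by `0` off the
good set, is measurable (pointwise limit of `labelCollisionSumApprox` on the good set; only the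
time-slice measurability `Φ.measurable_flow` is used). [folklore] -/
theorem measurable_indicator_collisionSum_Ioc_labels [TopologicalSpace E] [ContinuousAdd E]
    [TopologicalSpace.PseudoMetrizableSpace E] [BorelSpace E] [MeasurableAdd₂ E]
    (hG : G.IsHardSphereRegular ε) (hGm : G.IsMeasurable)
    (hFc : ∀ i j, Continuous (F i j)) (hFm : ∀ i j, Measurable (F i j)) (a b : ℝ) :
    Measurable (Φ.good.indicator fun z =>
      Φ.collisionSum (Ioc a b) (fun c => F c.fst c.snd c.mark) z) := by
  by_cases hab : a < b
  · refine measurable_of_tendsto_metrizable (f := fun n => Φ.good.indicator fun z =>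
      labelCollisionSumApprox G ε (fun t => Φ.flow t z) F a b n)
      (fun n => (Φ.measurable_labelCollisionSumApprox hGm hFm a b n).indicator
        Φ.measurableSet_good) ?_
    rw [tendsto_pi_nhds]
    intro z
    by_cases hz : z ∈ Φ.good
    · simp only [indicator_of_mem hz]
      exact (Φ.isTrajectory z hz).tendsto_labelCollisionSumApprox hG hab hFc
    · simp only [indicator_of_notMem hz]
      exact tendsto_const_nhds
  · have h0 : (fun z => Φ.collisionSum (Ioc a b) (fun c => F c.fst c.snd c.mark) z) =
        fun _ => 0 := by
      funext z
      rw [HardSphereFlow.collisionSum_eq, Ioc_eq_empty hab,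
        FluidPDE.collisionSum_eq_collisionPairSum, FluidPDE.collisionPairSum_empty]
    rw [h0]
    exact measurable_const.indicator Φ.measurableSet_good

/-- Transport of measurability through an identification valid on the good set: if there
`W z = Φ.collisionSum (Ioc a b) (fun c => F c.fst c.snd c.mark) z` (`F i j` continuous and
measurable), then `W`, extended by `0` off the good set, is measurable. The typical `W` is a
collision sum whose summand agrees with `F c.fst c.snd c.mark` on actual collisions only
(`collisionSum_congr`). [folklore] -/
theorem measurable_indicator_of_eqOn_collisionSum_labels [TopologicalSpace E] [ContinuousAdd E]
    [TopologicalSpace.PseudoMetrizableSpace E] [BorelSpace E] [MeasurableAdd₂ E]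
    (hG : G.IsHardSphereRegular ε) (hGm : G.IsMeasurable) (hFc : ∀ i j, Continuous (F i j))
    (hFm : ∀ i j, Measurable (F i j)) {W : Config N d X → E} (a b : ℝ)
    (hW : ∀ z ∈ Φ.good, W z = Φ.collisionSum (Ioc a b) (fun c => F c.fst c.snd c.mark) z) :
    Measurable (Φ.good.indicator W) := by
  rw [indicator_congr fun z hz => hW z hz]
  exact Φ.measurable_indicator_collisionSum_Ioc_labels hG hGm hFc hFm a b

/-- From an identification with a label-dependent collision sum on the good set to
a.e.-measurability under a law carried by the good set (Liouville, local Gibbs). [folklore] -/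
theorem aemeasurable_of_eqOn_collisionSum_labels [TopologicalSpace E] [ContinuousAdd E]
    [TopologicalSpace.PseudoMetrizableSpace E] [BorelSpace E] [MeasurableAdd₂ E]
    (hG : G.IsHardSphereRegular ε) (hGm : G.IsMeasurable) (hFc : ∀ i j, Continuous (F i j))
    (hFm : ∀ i j, Measurable (F i j)) {W : Config N d X → E} (a b : ℝ)
    (hW : ∀ z ∈ Φ.good, W z = Φ.collisionSum (Ioc a b) (fun c => F c.fst c.snd c.mark) z)
    {μ : Measure (Config N d X)} (hμ : ∀ᵐ z ∂μ, z ∈ Φ.good) : AEMeasurable W μ := by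
  refine ⟨_, Φ.measurable_indicator_of_eqOn_collisionSum_labels hG hGm hFc hFm a b hW, ?_⟩
  filter_upwards [hμ] with z hz
  exact (indicator_of_mem hz W).symm

end HardSphereFlow

end Kinetic

/-! ## On the flat torus with `ε < 1/2`: continuous families, no other side condition -/

section TorusGeometry

variable {d : Type*} [Fintype d] {N : ℕ} {ε : ℝ}

namespace HardSphereFlow

variable {E : Type*} [AddCommMonoid E] [MeasurableSpace E] [TopologicalSpace E] [ContinuousAdd E]
  [TopologicalSpace.PseudoMetrizableSpace E] [BorelSpace E] [MeasurableAdd₂ E]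

/-- On `T^d` with `ε < 1/2`, a label-dependent collision sum over `(a, b]` along the flow
(continuous family), extended by `0` off the good set, is measurable in the datum. [folklore] -/
theorem measurable_indicator_collisionSum_Ioc_labels_torus
    (Φ : HardSphereFlow (Torus.geometry d) ε N) (hε : ε < 2⁻¹)
    {F : Fin N → Fin N →
      ℝ × UnitAddTorus d × EuclideanSpace ℝ d × EuclideanSpace ℝ d × EuclideanSpace ℝ d → E}
    (hF : ∀ i j, Continuous (F i j)) (a b : ℝ) :
    Measurable (Φ.good.indicator fun z =>
      Φ.collisionSum (Ioc a b) (fun c => F c.fst c.snd c.mark) z) :=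
  Φ.measurable_indicator_collisionSum_Ioc_labels (Torus.isHardSphereRegular_geometry hε)
    Torus.isMeasurable_geometry hF (fun i j => (hF i j).measurable) a b

/-- On `T^d` with `ε < 1/2`: a functional that agrees on the good set with a label-dependent
collision sum over `(a, b]` is a.e.-measurable under any law carried by the good set. [folklore] -/
theorem aemeasurable_of_eqOn_collisionSum_labels_torus
    (Φ : HardSphereFlow (Torus.geometry d) ε N) (hε : ε < 2⁻¹)
    {F : Fin N → Fin N →
      ℝ × UnitAddTorus d × EuclideanSpace ℝ d × EuclideanSpace ℝ d × EuclideanSpace ℝ d → E}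
    (hF : ∀ i j, Continuous (F i j)) {W : Config N d (UnitAddTorus d) → E} (a b : ℝ)
    (hW : ∀ z ∈ Φ.good, W z = Φ.collisionSum (Ioc a b) (fun c => F c.fst c.snd c.mark) z)
    {μ : Measure (Config N d (UnitAddTorus d))} (hμ : ∀ᵐ z ∂μ, z ∈ Φ.good) :
    AEMeasurable W μ :=
  Φ.aemeasurable_of_eqOn_collisionSum_labels (Torus.isHardSphereRegular_geometry hε)
    Torus.isMeasurable_geometry hF (fun i j => (hF i j).measurable) a b hW hμ

end HardSphereFlow

end TorusGeometry

end

end Literature.Analysis.FluidPDE
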